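import Summits.QuantumFields.BalabanUV.T4Continuum.Support.VariationalCovariantTwoRunsSocketLocal
import Summits.QuantumFields.BalabanUV.T4Continuum.Spine.NE2VariationalTwoRunsFromNE3

/-!
# T⁴ programme, spine node NE2 (U1a), lane P2 — THE TWO-RUNS END ON NODE NE3's OWN LANDED CARRIER: `NE3Shape (minActReadings … (p2Loc L M Rt)) C θ`
# ⟹ `TowerLimitRate (fun _ ↦ 1) 1 (k ↦ Δ′_k(Rt V k, nested taxi)) (cTwoRuns …) (max θ L⁻¹)` for EVERY admissible datum `V`, all other binders
# of the road owner's END displayed (row B6′ pattern, by name on both ends)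

NE2 formalisation swarm `b2b-balaban-t4-ne2-formalise-*`, leaf prover 09 (gen 5); supplier item (O2′) of register row «P2-sup» (road owner
`b2b-balaban-t4-ne2-p2` gen 11, journal CLAIMS.log l.11188 (2), l.11313 (iii); the carrier typing was the owner's request l.10100 (c), answered for the
splice currency by leaf-09-g4's `Spine/NE2VariationalTwoRunsFromNE3` p214586 — THIS FILE is its twin for the RE-TARGETED raw-distance socket).
Inputs BY NAME: `Support/VariationalCovariantTwoRunsSocket.towerLimitRate_twoRuns_of_localRate_nest` and `Support/VariationalCovariantTwoRunsSocketLocal.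
towerLimitRate_twoRuns_of_localRate_local_nest` (this lineage, gen 5),
`Spine/NE2VariationalTwoRunsFromNE3.{p2Loc, localRate_minActReadings_iff_tow}` (gen 4), `Support/MinimalActionRate.minActReadings` (NE3 lineage,
owner t4-ne3-p1), node U1b's `T4EtaRateMin.{LocalRate, NE3Shape}`.
 * **`towerLimitRate_twoRuns_of_minActReadings`**: node U1b's local half `LocalRate (minActReadings d 𝒞 L N dom (p2Loc L M Rt)) C θ` (`0 ≤ C`,
   `0 ≤ θ < 1`) + the size class of the datum's tower `Rt V` (`V ∈ dom`) ⟹ the two-runs END for `Rc := Rt V` with nested-taxi transports, two-run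
   CLASS DISCHARGED, every other binder of `towerLimitRate_twoRuns_closed` (p215328) displayed on the canonical objects;
 * **`towerLimitRate_twoRuns_of_ne3Shape`**: the same from the full `NE3Shape` on that carrier (its `0 ≤ θ < 1` is all the rate needs);
 * **`towerLimitRate_twoRuns_of_ne3Shape_local`**: the FRAME-FREE form — the road owner's `VariationalCovariantEndLocal.towerLimitRate_twoRuns_closed_local`
   (p215541) through file 3 `VariationalCovariantTwoRunsSocketLocal.towerLimitRate_twoRuns_of_localRate_local_nest` (`1 ≤ d`; per-block smallness
   `2d(n w)² + 4γ² ≤ ½`, `2d(L m₁)² ≤ ½`, absorption `64d(n m)² ≤ ½` in place of the ten frame binders).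
WHAT IS LEFT (stated, not hidden): NE3 inhabits no local half today (route (A) = the ACTION half); whether `p2Loc` (axial-gauge phases at block-addressed
bonds) is node U1b's local deliverable is the NE3 owner lineage's word; the displayed binders at taxi data are (O7)∕(O10)∕(O12)'s; no B0.

HONEST FRAMING (T4-DAG p. 1).  Bookkeeping (compositions BY NAME); `Rt` DATA; NE3 OPEN (DISPLAYED); NE2 NOT proved; model level (U(1) charged-scalar
sector of road P2); spine PROVED 0∕9 unchanged; rung (B)+1 finite T⁴ — NOT infinite volume, NOT a mass gap, NOT Clay.  HONEST DEPENDENCY (cell,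
verbatim): continuum YM on T⁴ ⇐ BetaPertH ∧ nine spine estimates (0/9 proved); BetaPertH ⇐ (D1) ∧ (D4) ∧ CAP+tail; G-an2-4 gates asym, D1 and
NE2/3/4.  ABSOLUTE RULE kept; [folklore]; no `def`; no `def … : Prop` fact; no `sorry`; axioms standard.
-/

noncomputable section

open scoped Matrix ComplexConjugate ComplexOrder Matrix.Norms.L2Operator BigOperators

namespace Summit.QuantumFields.BalabanUV.T4Continuum.NE2VariationalTwoRunsEndFromNE3

open Literature.MathematicalPhysics.QuantumFieldTheory.Balaban1983to89
open Literature.MathematicalPhysics.QuantumFieldTheory.Balaban1983to89.B5Prop11Plancherel (Tor fine unitVec)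
open Literature.MathematicalPhysics.QuantumFieldTheory.Balaban1983to89.B5Prop11Lower (nsq)
open Literature.MathematicalPhysics.QuantumFieldTheory.Balaban1983to89.B5Block118 (bpt)
open Literature.MathematicalPhysics.QuantumFieldTheory.Balaban1983to89.T4EtaRateMin (LocalRate NE3Shape)
open Summit.QuantumFields.BalabanUV.T4Continuum.VariationalCovariantEffective (effSc)
open Summit.QuantumFields.BalabanUV.T4Continuum.VariationalCovariantFederbush (mis)
open Summit.QuantumFields.BalabanUV.T4Continuum.VariationalCovariantScalarPair (Sc qW Qk)
open Summit.QuantumFields.BalabanUV.T4Continuum.VariationalCovariantEnd (lamC)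
open Summit.QuantumFields.BalabanUV.T4Continuum.VariationalCovariantTwoRunsNE3 (fineOf)
open Summit.QuantumFields.BalabanUV.T4Continuum.VariationalCovariantTwoRunsEnd (cTwoRuns)
open Summit.QuantumFields.BalabanUV.T4Continuum.VariationalCovariantTwoRunsTransport (nestOf)
open Summit.QuantumFields.BalabanUV.T4Continuum.VariationalCovariantTwoRunsSocket (cRho towerLimitRate_twoRuns_of_localRate_nest)
open Summit.QuantumFields.BalabanUV.T4Continuum.VariationalCovariantTwoRunsSocketLocal (towerLimitRate_twoRuns_of_localRate_local_nest)
open Summit.QuantumFields.BalabanUV.T4Continuum.CovariantAveragingTower (TowerLimitRate)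
open Summit.QuantumFields.BalabanUV.T4Continuum.VariationalTaxiTransport (taxiT)
open Summit.QuantumFields.BalabanUV.T4Continuum.VariationalTaxiCoarse (coarseT)
open Summit.QuantumFields.BalabanUV.T4Continuum.MinimalActionRate (minActReadings)
open Summit.QuantumFields.BalabanUV.T4Continuum.NE2VariationalTwoRunsFromNE3 (p2Loc localRate_minActReadings_iff_tow)

variable {d : ℕ} (L : ℕ) [NeZero L] (M : Fin d → ℕ) [hM : ∀ μ, NeZero (M μ)]
variable {o : Type*} [Fintype o] [DecidableEq o]

section Carrier

variable {𝒞 : ℕ → Set (B7Prop1Explicit.Site d → Fin d → (Matrix o o ℂ)ˣ)} {N : ℕ}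
  {dom : Set (B7Prop1Explicit.Site d → Fin d → (Matrix o o ℂ)ˣ)}
  {Rt : (B7Prop1Explicit.Site d → Fin d → (Matrix o o ℂ)ˣ) → ((k : ℕ) → Tor (fine (L ^ k) M) → Fin d → ℂ)} {C θ : ℝ}
variable (Tb₀ : (k : ℕ) → Tor (fine (L ^ k) M) → ℂ)
variable (G : (k : ℕ) → Tor (fine (L ^ k) M) → ℂ) (c : (k : ℕ) → Tor M → ℂ) (mG mB : ℕ → ℝ)
variable (G' : (k : ℕ) → Tor (fine L (fine (L ^ k) M)) → ℂ) (c' : (k : ℕ) → Tor (fine (L ^ k) M) → ℂ) (mG' mB' : ℕ → ℝ)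
variable (m w w' a m₁ : ℕ → ℝ)

/-- **THE TWO-RUNS END ON NODE NE3's CARRIER, DATUM BY DATUM**: node U1b's local half `LocalRate (minActReadings d 𝒞 L N dom (p2Loc L M Rt)) C θ`
(`0 ≤ C`, `0 ≤ θ < 1`) + the size class of `Rt V` (`V ∈ dom`, unit phases) ⟹ `towerLimitRate_twoRuns_of_localRate_nest` for `Rc := Rt V`:
`TowerLimitRate (fun _ ↦ 1) 1 (fun k => effSc (L^k) M (Rt V k) (nestOf L M k (Rt V k)) a₀) (cTwoRuns d L c_w′ c_a c_m c₁ c_ρ (d·c_ρ)) (max θ L⁻¹)`,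
`c_ρ = 2C + (α²∕2)e^α`; every other binder of p215328 displayed on the canonical objects.  NE3 NOT discharged; NE2 NOT proved. [folklore] -/
theorem towerLimitRate_twoRuns_of_minActReadings (hL : 2 ≤ L) {α : ℝ} (hC : 0 ≤ C) (hθ0 : 0 ≤ θ) (hθ1 : θ < 1) (hα : 0 ≤ α)
    (h : LocalRate (minActReadings d 𝒞 L N dom (p2Loc L M Rt)) C θ) {V : B7Prop1Explicit.Site d → Fin d → (Matrix o o ℂ)ˣ} (hV : V ∈ dom)
    (hR1 : ∀ k x μ, ‖Rt V k x μ‖ = 1) (hsize : ∀ k x μ, ‖((L ^ k : ℕ) : ℂ) * (Rt V k x μ - 1)‖ ≤ α)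
    (hUBk : ∀ k (μ : Tor M → ℂ), ∃ f, Qk (L ^ k) M (nestOf L M k (Rt V k)) f = μ ∧
      Sc (L ^ k) M (Rt V k) f ≤ lamC d ((((L ^ k : ℕ)) : ℝ) * w' k) * nsq μ)
    (hPk : ∀ k f, qW (L ^ k) M f ≤ (1088 * (d : ℝ) + 128) * (Sc (L ^ k) M (Rt V k) f + nsq (Qk (L ^ k) M (nestOf L M k (Rt V k)) f)))
    (hG : ∀ k x, ‖G k x‖ = 1) (hc : ∀ k z, ‖c k z‖ ≤ 1)
    (hframe : ∀ k x μ, ‖G k (x + unitVec (fine (L ^ k) M) μ) - G k x * coarseT L (fine (L ^ k) M) (fineOf L M (Rt V) k) x μ‖ ≤ mG k)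
    (hblock : ∀ k z j, ‖G k (bpt (L ^ k) M z j)
      - c k z * nestOf L M k (coarseT L (fine (L ^ k) M) (fineOf L M (Rt V) k)) (bpt (L ^ k) M z j)‖ ≤ mB k)
    (hsmall : ∀ k, 16 * (d : ℝ) ^ 2 * ((((L ^ k : ℕ)) : ℝ) * mG k) ^ 2 + 4 * mB k ^ 2 ≤ 1 / 2)
    (hG' : ∀ k x, ‖G' k x‖ = 1) (hc' : ∀ k y, ‖c' k y‖ ≤ 1)
    (hframe' : ∀ k x μ, ‖G' k (x + unitVec (fine L (fine (L ^ k) M)) μ) - G' k x * fineOf L M (Rt V) k x μ‖ ≤ mG' k)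
    (hblock' : ∀ k y j, ‖G' k (bpt L (fine (L ^ k) M) y j)
      - c' k y * taxiT L (fine (L ^ k) M) (fineOf L M (Rt V) k) (bpt L (fine (L ^ k) M) y j)‖ ≤ mB' k)
    (hsmall' : ∀ k, 16 * (d : ℝ) ^ 2 * ((L : ℝ) * mG' k) ^ 2 + 4 * mB' k ^ 2 ≤ 1 / 2)
    (hm : ∀ k, 0 ≤ m k)
    (hmis : ∀ k y μ j, ‖mis L (fine (L ^ k) M) (coarseT L (fine (L ^ k) M) (fineOf L M (Rt V) k)) (fineOf L M (Rt V) k)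
      (taxiT L (fine (L ^ k) M) (fineOf L M (Rt V) k)) y μ j‖ ≤ m k)
    (habsorb : ∀ k, 512 * (d : ℝ) ^ 2 * ((((L ^ k : ℕ)) : ℝ) * m k) ^ 2 ≤ 1 / 2)
    (hTb₀ : ∀ k x, ‖Tb₀ k x‖ = 1) (hw : ∀ k, 0 ≤ w k)
    (hwin : ∀ k (y : Tor M) (j : Fin d → Fin (L ^ k)) (μ : Fin d), (j μ : ℕ) + 1 < L ^ k →
      ‖coarseT L (fine (L ^ k) M) (fineOf L M (Rt V) k) (bpt (L ^ k) M y j) μ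
          * (starRingEnd ℂ) (Tb₀ k (bpt (L ^ k) M y j + unitVec (fine (L ^ k) M) μ)) * Tb₀ k (bpt (L ^ k) M y j) - 1‖ ≤ w k)
    {γ : ℝ} (hγ : γ < 1)
    (hrel : ∀ k x, ‖nestOf L M k (coarseT L (fine (L ^ k) M) (fineOf L M (Rt V) k)) x * (starRingEnd ℂ) (Tb₀ k x) - 1‖ ≤ γ)
    (hw'0 : ∀ k, 0 ≤ w' k) (hw' : ∀ k, (4 + (((L ^ k : ℕ)) : ℝ) * w k) / (1 - γ) - 1 ≤ (((L ^ k : ℕ)) : ℝ) * w' k)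
    (ha : ∀ k, 0 ≤ a k)
    (hP : ∀ k x μ ν, ‖coarseT L (fine (L ^ k) M) (fineOf L M (Rt V) k) x μ
        * coarseT L (fine (L ^ k) M) (fineOf L M (Rt V) k) (x + unitVec (fine (L ^ k) M) μ) ν
      - coarseT L (fine (L ^ k) M) (fineOf L M (Rt V) k) x ν
        * coarseT L (fine (L ^ k) M) (fineOf L M (Rt V) k) (x + unitVec (fine (L ^ k) M) ν) μ‖ ≤ a k)
    (hm₁ : ∀ k, 0 ≤ m₁ k)
    (hin : ∀ k (y : Tor (fine (L ^ k) M)) (j : Fin d → Fin L) (μ : Fin d), (j μ : ℕ) + 1 < L →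
      ‖fineOf L M (Rt V) k (bpt L (fine (L ^ k) M) y j) μ
          * (starRingEnd ℂ) (taxiT L (fine (L ^ k) M) (fineOf L M (Rt V) k) (bpt L (fine (L ^ k) M) y j + unitVec (fine L (fine (L ^ k) M)) μ))
          * taxiT L (fine (L ^ k) M) (fineOf L M (Rt V) k) (bpt L (fine (L ^ k) M) y j) - 1‖ ≤ m₁ k)
    (hcross : ∀ k (y : Tor (fine (L ^ k) M)) (j : Fin d → Fin L) (μ : Fin d), (j μ : ℕ) + 1 = L →
      ‖fineOf L M (Rt V) k (bpt L (fine (L ^ k) M) y j) μ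
          * (starRingEnd ℂ) (taxiT L (fine (L ^ k) M) (fineOf L M (Rt V) k) (bpt L (fine (L ^ k) M) y j + unitVec (fine L (fine (L ^ k) M)) μ))
          * taxiT L (fine (L ^ k) M) (fineOf L M (Rt V) k) (bpt L (fine (L ^ k) M) y j)
        - coarseT L (fine (L ^ k) M) (fineOf L M (Rt V) k) y μ‖ ≤ m₁ k)
    {cw ca cm c₁ : ℝ}
    (hwc : ∀ k, (((L ^ k : ℕ)) : ℝ) * w' k ≤ cw) (hac : ∀ k, a k * (((L ^ k : ℕ)) : ℝ) ^ 2 ≤ ca)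
    (hmc : ∀ k, (((L ^ k : ℕ)) : ℝ) ^ 2 * m k ≤ cm) (hm₁c : ∀ k, (((L ^ k : ℕ)) : ℝ) ^ 2 * m₁ k ≤ c₁)
    {a₀ : ℝ} (ha₀ : 0 < a₀) :
    TowerLimitRate (ι := fun _ => Tor M) (fun _ => (1 : Matrix (Tor M) (Tor M) ℂ)) 1
      (fun k => effSc (L ^ k) M (Rt V k) (nestOf L M k (Rt V k)) a₀) (cTwoRuns d L cw ca cm c₁ (cRho C α) ((d : ℝ) * cRho C α))
      (max θ (L : ℝ)⁻¹) :=
  towerLimitRate_twoRuns_of_localRate_nest L M (Rt V) Tb₀ G c mG mB G' c' mG' mB' m w w' a m₁ hL hC hθ0 hθ1 hα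
    ((localRate_minActReadings_iff_tow L M).1 h) ⟨V, hV, rfl⟩ hR1 hsize hUBk hPk hG hc hframe hblock hsmall hG' hc' hframe' hblock' hsmall'
    hm hmis habsorb hTb₀ hw hwin hγ hrel hw'0 hw' ha hP hm₁ hin hcross hwc hac hmc hm₁c ha₀

/-- **THE SAME FROM THE FULL `NE3Shape` ON NE3's CARRIER** (its `0 ≤ θ < 1` is all the rate needs; `0 ≤ C`). [folklore] -/
theorem towerLimitRate_twoRuns_of_ne3Shape (hL : 2 ≤ L) {α : ℝ} (hC : 0 ≤ C) (hα : 0 ≤ α)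
    (h : NE3Shape (minActReadings d 𝒞 L N dom (p2Loc L M Rt)) C θ) {V : B7Prop1Explicit.Site d → Fin d → (Matrix o o ℂ)ˣ} (hV : V ∈ dom)
    (hR1 : ∀ k x μ, ‖Rt V k x μ‖ = 1) (hsize : ∀ k x μ, ‖((L ^ k : ℕ) : ℂ) * (Rt V k x μ - 1)‖ ≤ α)
    (hUBk : ∀ k (μ : Tor M → ℂ), ∃ f, Qk (L ^ k) M (nestOf L M k (Rt V k)) f = μ ∧
      Sc (L ^ k) M (Rt V k) f ≤ lamC d ((((L ^ k : ℕ)) : ℝ) * w' k) * nsq μ)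
    (hPk : ∀ k f, qW (L ^ k) M f ≤ (1088 * (d : ℝ) + 128) * (Sc (L ^ k) M (Rt V k) f + nsq (Qk (L ^ k) M (nestOf L M k (Rt V k)) f)))
    (hG : ∀ k x, ‖G k x‖ = 1) (hc : ∀ k z, ‖c k z‖ ≤ 1)
    (hframe : ∀ k x μ, ‖G k (x + unitVec (fine (L ^ k) M) μ) - G k x * coarseT L (fine (L ^ k) M) (fineOf L M (Rt V) k) x μ‖ ≤ mG k)
    (hblock : ∀ k z j, ‖G k (bpt (L ^ k) M z j)
      - c k z * nestOf L M k (coarseT L (fine (L ^ k) M) (fineOf L M (Rt V) k)) (bpt (L ^ k) M z j)‖ ≤ mB k)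
    (hsmall : ∀ k, 16 * (d : ℝ) ^ 2 * ((((L ^ k : ℕ)) : ℝ) * mG k) ^ 2 + 4 * mB k ^ 2 ≤ 1 / 2)
    (hG' : ∀ k x, ‖G' k x‖ = 1) (hc' : ∀ k y, ‖c' k y‖ ≤ 1)
    (hframe' : ∀ k x μ, ‖G' k (x + unitVec (fine L (fine (L ^ k) M)) μ) - G' k x * fineOf L M (Rt V) k x μ‖ ≤ mG' k)
    (hblock' : ∀ k y j, ‖G' k (bpt L (fine (L ^ k) M) y j)
      - c' k y * taxiT L (fine (L ^ k) M) (fineOf L M (Rt V) k) (bpt L (fine (L ^ k) M) y j)‖ ≤ mB' k)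
    (hsmall' : ∀ k, 16 * (d : ℝ) ^ 2 * ((L : ℝ) * mG' k) ^ 2 + 4 * mB' k ^ 2 ≤ 1 / 2)
    (hm : ∀ k, 0 ≤ m k)
    (hmis : ∀ k y μ j, ‖mis L (fine (L ^ k) M) (coarseT L (fine (L ^ k) M) (fineOf L M (Rt V) k)) (fineOf L M (Rt V) k)
      (taxiT L (fine (L ^ k) M) (fineOf L M (Rt V) k)) y μ j‖ ≤ m k)
    (habsorb : ∀ k, 512 * (d : ℝ) ^ 2 * ((((L ^ k : ℕ)) : ℝ) * m k) ^ 2 ≤ 1 / 2)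
    (hTb₀ : ∀ k x, ‖Tb₀ k x‖ = 1) (hw : ∀ k, 0 ≤ w k)
    (hwin : ∀ k (y : Tor M) (j : Fin d → Fin (L ^ k)) (μ : Fin d), (j μ : ℕ) + 1 < L ^ k →
      ‖coarseT L (fine (L ^ k) M) (fineOf L M (Rt V) k) (bpt (L ^ k) M y j) μ
          * (starRingEnd ℂ) (Tb₀ k (bpt (L ^ k) M y j + unitVec (fine (L ^ k) M) μ)) * Tb₀ k (bpt (L ^ k) M y j) - 1‖ ≤ w k)
    {γ : ℝ} (hγ : γ < 1)
    (hrel : ∀ k x, ‖nestOf L M k (coarseT L (fine (L ^ k) M) (fineOf L M (Rt V) k)) x * (starRingEnd ℂ) (Tb₀ k x) - 1‖ ≤ γ)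
    (hw'0 : ∀ k, 0 ≤ w' k) (hw' : ∀ k, (4 + (((L ^ k : ℕ)) : ℝ) * w k) / (1 - γ) - 1 ≤ (((L ^ k : ℕ)) : ℝ) * w' k)
    (ha : ∀ k, 0 ≤ a k)
    (hP : ∀ k x μ ν, ‖coarseT L (fine (L ^ k) M) (fineOf L M (Rt V) k) x μ
        * coarseT L (fine (L ^ k) M) (fineOf L M (Rt V) k) (x + unitVec (fine (L ^ k) M) μ) ν
      - coarseT L (fine (L ^ k) M) (fineOf L M (Rt V) k) x ν
        * coarseT L (fine (L ^ k) M) (fineOf L M (Rt V) k) (x + unitVec (fine (L ^ k) M) ν) μ‖ ≤ a k)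
    (hm₁ : ∀ k, 0 ≤ m₁ k)
    (hin : ∀ k (y : Tor (fine (L ^ k) M)) (j : Fin d → Fin L) (μ : Fin d), (j μ : ℕ) + 1 < L →
      ‖fineOf L M (Rt V) k (bpt L (fine (L ^ k) M) y j) μ
          * (starRingEnd ℂ) (taxiT L (fine (L ^ k) M) (fineOf L M (Rt V) k) (bpt L (fine (L ^ k) M) y j + unitVec (fine L (fine (L ^ k) M)) μ))
          * taxiT L (fine (L ^ k) M) (fineOf L M (Rt V) k) (bpt L (fine (L ^ k) M) y j) - 1‖ ≤ m₁ k)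
    (hcross : ∀ k (y : Tor (fine (L ^ k) M)) (j : Fin d → Fin L) (μ : Fin d), (j μ : ℕ) + 1 = L →
      ‖fineOf L M (Rt V) k (bpt L (fine (L ^ k) M) y j) μ
          * (starRingEnd ℂ) (taxiT L (fine (L ^ k) M) (fineOf L M (Rt V) k) (bpt L (fine (L ^ k) M) y j + unitVec (fine L (fine (L ^ k) M)) μ))
          * taxiT L (fine (L ^ k) M) (fineOf L M (Rt V) k) (bpt L (fine (L ^ k) M) y j)
        - coarseT L (fine (L ^ k) M) (fineOf L M (Rt V) k) y μ‖ ≤ m₁ k)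
    {cw ca cm c₁ : ℝ}
    (hwc : ∀ k, (((L ^ k : ℕ)) : ℝ) * w' k ≤ cw) (hac : ∀ k, a k * (((L ^ k : ℕ)) : ℝ) ^ 2 ≤ ca)
    (hmc : ∀ k, (((L ^ k : ℕ)) : ℝ) ^ 2 * m k ≤ cm) (hm₁c : ∀ k, (((L ^ k : ℕ)) : ℝ) ^ 2 * m₁ k ≤ c₁)
    {a₀ : ℝ} (ha₀ : 0 < a₀) :
    TowerLimitRate (ι := fun _ => Tor M) (fun _ => (1 : Matrix (Tor M) (Tor M) ℂ)) 1
      (fun k => effSc (L ^ k) M (Rt V k) (nestOf L M k (Rt V k)) a₀) (cTwoRuns d L cw ca cm c₁ (cRho C α) ((d : ℝ) * cRho C α))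
      (max θ (L : ℝ)⁻¹) :=
  towerLimitRate_twoRuns_of_minActReadings L M Tb₀ G c mG mB G' c' mG' mB' m w w' a m₁ hL hC h.rate_nonneg h.rate_lt_one hα h.pointwise hV
    hR1 hsize hUBk hPk hG hc hframe hblock hsmall hG' hc' hframe' hblock' hsmall' hm hmis habsorb hTb₀ hw hwin hγ hrel hw'0 hw' ha hP hm₁ hin
    hcross hwc hac hmc hm₁c ha₀

/-- **THE FRAME-FREE TWO-RUNS END ON NODE NE3's CARRIER** from the full `NE3Shape` (`0 ≤ C`, `1 ≤ d`): the road owner's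
`towerLimitRate_twoRuns_closed_local` (p215541) for `Rc := Rt V` with nested-taxi transports, two-run CLASS DISCHARGED, per-block smallness
lines in place of the frames; every other binder displayed on the canonical objects.  NE3 NOT discharged; NE2 NOT proved. [folklore] -/
theorem towerLimitRate_twoRuns_of_ne3Shape_local (hd : 1 ≤ d) (hL : 2 ≤ L) {α : ℝ} (hC : 0 ≤ C) (hα : 0 ≤ α)
    (h : NE3Shape (minActReadings d 𝒞 L N dom (p2Loc L M Rt)) C θ) {V : B7Prop1Explicit.Site d → Fin d → (Matrix o o ℂ)ˣ} (hV : V ∈ dom)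
    (hR1 : ∀ k x μ, ‖Rt V k x μ‖ = 1) (hsize : ∀ k x μ, ‖((L ^ k : ℕ) : ℂ) * (Rt V k x μ - 1)‖ ≤ α)
    (hUBk : ∀ k (μ : Tor M → ℂ), ∃ f, Qk (L ^ k) M (nestOf L M k (Rt V k)) f = μ ∧
      Sc (L ^ k) M (Rt V k) f ≤ lamC d ((((L ^ k : ℕ)) : ℝ) * w' k) * nsq μ)
    (hPk : ∀ k f, qW (L ^ k) M f ≤ (1088 * (d : ℝ) + 128) * (Sc (L ^ k) M (Rt V k) f + nsq (Qk (L ^ k) M (nestOf L M k (Rt V k)) f)))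
    (hm : ∀ k, 0 ≤ m k)
    (hmis : ∀ k y μ j, ‖mis L (fine (L ^ k) M) (coarseT L (fine (L ^ k) M) (fineOf L M (Rt V) k)) (fineOf L M (Rt V) k)
      (taxiT L (fine (L ^ k) M) (fineOf L M (Rt V) k)) y μ j‖ ≤ m k)
    (habsorb : ∀ k, 64 * (d : ℝ) * ((((L ^ k : ℕ)) : ℝ) * m k) ^ 2 ≤ 1 / 2)
    (hTb₀ : ∀ k x, ‖Tb₀ k x‖ = 1) (hw : ∀ k, 0 ≤ w k)
    (hwin : ∀ k (y : Tor M) (j : Fin d → Fin (L ^ k)) (μ : Fin d), (j μ : ℕ) + 1 < L ^ k →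
      ‖coarseT L (fine (L ^ k) M) (fineOf L M (Rt V) k) (bpt (L ^ k) M y j) μ
          * (starRingEnd ℂ) (Tb₀ k (bpt (L ^ k) M y j + unitVec (fine (L ^ k) M) μ)) * Tb₀ k (bpt (L ^ k) M y j) - 1‖ ≤ w k)
    {γ : ℝ} (hγ : γ < 1)
    (hrel : ∀ k x, ‖nestOf L M k (coarseT L (fine (L ^ k) M) (fineOf L M (Rt V) k)) x * (starRingEnd ℂ) (Tb₀ k x) - 1‖ ≤ γ)
    (hsmall : ∀ k, 2 * (d : ℝ) * ((((L ^ k : ℕ)) : ℝ) * w k) ^ 2 + 4 * γ ^ 2 ≤ 1 / 2)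
    (hw'0 : ∀ k, 0 ≤ w' k) (hw' : ∀ k, (4 + (((L ^ k : ℕ)) : ℝ) * w k) / (1 - γ) - 1 ≤ (((L ^ k : ℕ)) : ℝ) * w' k)
    (ha : ∀ k, 0 ≤ a k)
    (hP : ∀ k x μ ν, ‖coarseT L (fine (L ^ k) M) (fineOf L M (Rt V) k) x μ
        * coarseT L (fine (L ^ k) M) (fineOf L M (Rt V) k) (x + unitVec (fine (L ^ k) M) μ) ν
      - coarseT L (fine (L ^ k) M) (fineOf L M (Rt V) k) x ν
        * coarseT L (fine (L ^ k) M) (fineOf L M (Rt V) k) (x + unitVec (fine (L ^ k) M) ν) μ‖ ≤ a k)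
    (hm₁ : ∀ k, 0 ≤ m₁ k)
    (hin : ∀ k (y : Tor (fine (L ^ k) M)) (j : Fin d → Fin L) (μ : Fin d), (j μ : ℕ) + 1 < L →
      ‖fineOf L M (Rt V) k (bpt L (fine (L ^ k) M) y j) μ
          * (starRingEnd ℂ) (taxiT L (fine (L ^ k) M) (fineOf L M (Rt V) k) (bpt L (fine (L ^ k) M) y j + unitVec (fine L (fine (L ^ k) M)) μ))
          * taxiT L (fine (L ^ k) M) (fineOf L M (Rt V) k) (bpt L (fine (L ^ k) M) y j) - 1‖ ≤ m₁ k)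
    (hcross : ∀ k (y : Tor (fine (L ^ k) M)) (j : Fin d → Fin L) (μ : Fin d), (j μ : ℕ) + 1 = L →
      ‖fineOf L M (Rt V) k (bpt L (fine (L ^ k) M) y j) μ
          * (starRingEnd ℂ) (taxiT L (fine (L ^ k) M) (fineOf L M (Rt V) k) (bpt L (fine (L ^ k) M) y j + unitVec (fine L (fine (L ^ k) M)) μ))
          * taxiT L (fine (L ^ k) M) (fineOf L M (Rt V) k) (bpt L (fine (L ^ k) M) y j)
        - coarseT L (fine (L ^ k) M) (fineOf L M (Rt V) k) y μ‖ ≤ m₁ k)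
    (hsmall₁ : ∀ k, 2 * (d : ℝ) * ((L : ℝ) * m₁ k) ^ 2 ≤ 1 / 2)
    {cw ca cm c₁ : ℝ}
    (hwc : ∀ k, (((L ^ k : ℕ)) : ℝ) * w' k ≤ cw) (hac : ∀ k, a k * (((L ^ k : ℕ)) : ℝ) ^ 2 ≤ ca)
    (hmc : ∀ k, (((L ^ k : ℕ)) : ℝ) ^ 2 * m k ≤ cm) (hm₁c : ∀ k, (((L ^ k : ℕ)) : ℝ) ^ 2 * m₁ k ≤ c₁)
    {a₀ : ℝ} (ha₀ : 0 < a₀) :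
    TowerLimitRate (ι := fun _ => Tor M) (fun _ => (1 : Matrix (Tor M) (Tor M) ℂ)) 1
      (fun k => effSc (L ^ k) M (Rt V k) (nestOf L M k (Rt V k)) a₀) (cTwoRuns d L cw ca cm c₁ (cRho C α) ((d : ℝ) * cRho C α))
      (max θ (L : ℝ)⁻¹) :=
  towerLimitRate_twoRuns_of_localRate_local_nest L M (Rt V) Tb₀ m w w' a m₁ hd hL hC h.rate_nonneg h.rate_lt_one hα
    ((localRate_minActReadings_iff_tow L M).1 h.pointwise) ⟨V, hV, rfl⟩ hR1 hsize hUBk hPk hm hmis habsorb hTb₀ hw hwin hγ hrel hsmall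
    hw'0 hw' ha hP hm₁ hin hcross hsmall₁ hwc hac hmc hm₁c ha₀

end Carrier

end Summit.QuantumFields.BalabanUV.T4Continuum.NE2VariationalTwoRunsEndFromNE3

end
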